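import Mathlib.Probability.Kernel.IonescuTulcea.Traj
import Mathlib.Probability.Kernel.Disintegration.StandardBorel
import HarnessLib

/-!
# A chain of couplings realised on one probability space

Topic `Literature/Probability/Distributions` (two definitions with API, proofs; no named fact).
Let `S` be a standard Borel space and `P 0, P 1, …` probability measures on `S × S` —
*couplings* — which are **consecutive**: the second marginal of `P n` is the first marginal of
`P (n + 1)`. Then there is a probability measure on the sequence space `ℕ → S` under which the
pair of coordinates `(x n, x (n+1))` has law `P n` for every `n` (`map_pair_chainMeasure`), and
the coordinate `x n` has law the first marginal of `P n` (`map_eval_chainMeasure`). It is the law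
of the Markov chain started from the first marginal of `P 0` with the transition kernels
"`x (n+1)` given `x n` distributed as the conditional law of `P n` given its first coordinate"
(`chainKernel`, Mathlib's disintegration `Measure.condKernel`), built by the Ionescu-Tulcea
theorem (Mathlib's `ProbabilityTheory.Kernel.trajMeasure`); the identification of the pair laws
is Mathlib's `map_frestrictLe_trajMeasure_compProd_eq_map_trajMeasure` followed by the base
change `(π × id)_* (ν ⊗ (κ ∘ π)) = (π_* ν) ⊗ κ` (`map_prodMap_compProd_comap'`) and the
disintegration identity `(P n).fst ⊗ condKernel = P n`.

This is the device by which a `d`-Cauchy sequence of *laws* (for a coupling distance `d` such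
as Lévy–Prokhorov, Wasserstein, or DKKMO's `d_CN`) is realised as an almost surely Cauchy
sequence of random variables (Kallenberg, *Foundations of Modern Probability* (2002), proof of
Thm 4.26 via Thm 6.10 (transfer) / Cor. 6.11; Villani, *Optimal Transport* (2009), Ch. 1, gluing;
C. Ionescu Tulcea, 1949).

## References

* O. Kallenberg, *Foundations of Modern Probability*, 2nd ed. (2002), Thm 6.10, Cor. 6.11,
  Thm 6.17 (Ionescu Tulcea).
* C. Villani, *Optimal Transport, Old and New* (2009), Ch. 1 (Gluing lemma).
-/

noncomputable section

open MeasureTheory ProbabilityTheory Finset Preorder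

namespace Literature.Probability.Distributions

variable {S : Type*}

/-! ### Base change for the composition-product (a copy) -/

/-- `(f × id)_* (ν ⊗ (κ ∘ f)) = (f_* ν) ⊗ κ` (a copy, for s-finite data, of
`RandomPlanarGeometry.map_prodMap_compProd_comap`, kept here to keep the import closure small). [folklore] -/
theorem map_prodMap_compProd_comap' {T Ω A : Type*} [MeasurableSpace T] [MeasurableSpace Ω]
    [MeasurableSpace A] (ν : Measure T) [SFinite ν] (κ : Kernel Ω A) [IsSFiniteKernel κ]
    {f : T → Ω} (hf : Measurable f) :
    (ν ⊗ₘ (κ.comap f hf)).map (Prod.map f id) = (ν.map f) ⊗ₘ κ := by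
  ext s hs
  rw [Measure.map_apply (hf.prodMap measurable_id) hs,
    Measure.compProd_apply ((hf.prodMap measurable_id) hs), Measure.compProd_apply hs,
    lintegral_map (Kernel.measurable_kernel_prodMk_left hs) hf]
  simp only [Kernel.comap_apply]
  rfl

/-! ### The last coordinate of a partial trajectory -/

/-- The coordinate `n` of a partial trajectory `y : Π i ≤ n, S`. [folklore] -/
def lastCoord (n : ℕ) (y : Π _ : Iic n, S) : S := y ⟨n, mem_Iic.2 le_rfl⟩

/-- `lastCoord n (frestrictLe n x) = x n`. [folklore] -/
@[simp] theorem lastCoord_frestrictLe (n : ℕ) (x : ℕ → S) : lastCoord n (frestrictLe n x) = x n :=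
  rfl

/-- `lastCoord` is measurable. [folklore] -/
theorem measurable_lastCoord [MeasurableSpace S] (n : ℕ) : Measurable (lastCoord (S := S) n) :=
  measurable_pi_apply _

/-! ### The chain -/

section Chain

variable [MeasurableSpace S] [StandardBorelSpace S] [Nonempty S] (P : ℕ → Measure (S × S))
  [∀ n, IsProbabilityMeasure (P n)]

/-- **The transition kernels of the chain of couplings**: from a partial trajectory up to time
`n`, the next point is drawn from the conditional law of `P n` given that its first coordinate
is the current point `x n` (Mathlib's `Measure.condKernel`). [folklore] -/
def chainKernel (n : ℕ) : Kernel (Π _ : Iic n, S) S :=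
  ((P n).condKernel).comap (lastCoord n) (measurable_lastCoord n)

/-- The transition kernels of the chain are Markov kernels. [folklore] -/
instance instIsMarkovKernelChainKernel (n : ℕ) : IsMarkovKernel (chainKernel P n) := by
  unfold chainKernel; infer_instance

/-- **The chain of couplings**: the law on `ℕ → S` of the Markov chain started from the first
marginal of `P 0` with transition kernels `chainKernel P` (Ionescu-Tulcea, Mathlib's
`Kernel.trajMeasure`). [folklore] -/
def chainMeasure : Measure (ℕ → S) :=
  Kernel.trajMeasure (X := fun _ ↦ S) (P 0).fst (chainKernel P)

/-- The chain of probability couplings is a probability measure. [folklore] -/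
instance instIsProbabilityMeasureChainMeasure : IsProbabilityMeasure (chainMeasure P) := by
  unfold chainMeasure; infer_instance

/-- The law of the starting point is the first marginal of `P 0`. [folklore] -/
theorem map_eval_zero_chainMeasure : (chainMeasure P).map (fun x ↦ x 0) = (P 0).fst := by
  have hπ : Measurable (lastCoord (S := S) 0) := measurable_lastCoord 0
  have e : (fun x : ℕ → S ↦ x 0) = lastCoord 0 ∘ frestrictLe 0 := rfl
  rw [chainMeasure, Kernel.trajMeasure, e, Measure.map_comp _ _ (hπ.comp (measurable_frestrictLe 0)),
    Kernel.map_comp_right _ (measurable_frestrictLe 0) hπ, Kernel.traj_map_frestrictLe,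
    Kernel.partialTraj_self, Kernel.id_map hπ, Measure.deterministic_comp_eq_map,
    Measure.map_map hπ (MeasurableEquiv.measurable _)]
  have hid : lastCoord (S := S) 0 ∘ (MeasurableEquiv.piUnique fun _ : Iic 0 ↦ S).symm = id := by
    funext s
    simp [lastCoord, MeasurableEquiv.piUnique]
  rw [hid, Measure.map_id]

/-- **Coordinates and pairs of the chain of couplings.** If the couplings are consecutive
(`(P (n+1)).fst = (P n).snd`), then under `chainMeasure P` the coordinate `x n` has law
`(P n).fst` and the pair `(x n, x (n+1))` has law `P n`. [folklore] -/
theorem map_eval_and_pair_chainMeasure (hcons : ∀ n, (P (n + 1)).fst = (P n).snd) (n : ℕ) :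
    (chainMeasure P).map (fun x ↦ x n) = (P n).fst ∧
      (chainMeasure P).map (fun x ↦ (x n, x (n + 1))) = P n := by
  induction n with
  | zero =>
    exact ⟨map_eval_zero_chainMeasure P, pair_of_eval 0 (map_eval_zero_chainMeasure P)⟩
  | succ n ih =>
    have hpair := ih.2
    have heval : (chainMeasure P).map (fun x ↦ x (n + 1)) = (P (n + 1)).fst := by
      rw [hcons, ← hpair, Measure.snd_map_prodMk (measurable_pi_apply n)]
    exact ⟨heval, pair_of_eval (n + 1) heval⟩
where
  /-- the pair law from the coordinate law (Ionescu-Tulcea step + base change + disintegration) -/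
  pair_of_eval (n : ℕ) (heval : (chainMeasure P).map (fun x ↦ x n) = (P n).fst) :
      (chainMeasure P).map (fun x ↦ (x n, x (n + 1))) = P n := by
    have key := Kernel.map_frestrictLe_trajMeasure_compProd_eq_map_trajMeasure
      (X := fun _ ↦ S) (μ₀ := (P 0).fst) (κ := chainKernel P) (a := n)
    change (chainMeasure P).map (frestrictLe n) ⊗ₘ chainKernel P n =
      (chainMeasure P).map (fun x ↦ (frestrictLe n x, x (n + 1))) at key
    have hπ : Measurable (lastCoord (S := S) n) := measurable_lastCoord n
    have h1 : ((chainMeasure P).map (fun x ↦ (frestrictLe n x, x (n + 1)))).map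
        (Prod.map (lastCoord n) id) = (chainMeasure P).map (fun x ↦ (x n, x (n + 1))) := by
      rw [Measure.map_map (hπ.prodMap measurable_id)
        ((measurable_frestrictLe n).prodMk (measurable_pi_apply (n + 1)))]
      rfl
    have h2 : ((chainMeasure P).map (frestrictLe n) ⊗ₘ chainKernel P n).map
        (Prod.map (lastCoord n) id) = P n := by
      rw [chainKernel, map_prodMap_compProd_comap', Measure.map_map hπ (measurable_frestrictLe n)]
      change (chainMeasure P).map (fun x ↦ x n) ⊗ₘ (P n).condKernel = P n
      rw [heval]
      exact Measure.disintegrate (P n) (P n).condKernel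
    rw [← h1, ← key, h2]

/-- Under the chain of consecutive couplings the coordinate `x n` has law `(P n).fst`. [folklore] -/
theorem map_eval_chainMeasure (hcons : ∀ n, (P (n + 1)).fst = (P n).snd) (n : ℕ) :
    (chainMeasure P).map (fun x ↦ x n) = (P n).fst :=
  (map_eval_and_pair_chainMeasure P hcons n).1

/-- **Under the chain of consecutive couplings the pair `(x n, x (n+1))` has law `P n`.** [folklore] -/
theorem map_pair_chainMeasure (hcons : ∀ n, (P (n + 1)).fst = (P n).snd) (n : ℕ) :
    (chainMeasure P).map (fun x ↦ (x n, x (n + 1))) = P n :=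
  (map_eval_and_pair_chainMeasure P hcons n).2

/-- The probability, under the chain, that the pair `(x n, x (n+1))` falls in a measurable set
is its `P n`-measure. [folklore] -/
theorem chainMeasure_preimage_pair (hcons : ∀ n, (P (n + 1)).fst = (P n).snd) (n : ℕ)
    {A : Set (S × S)} (hA : MeasurableSet A) :
    chainMeasure P {x | (x n, x (n + 1)) ∈ A} = P n A := by
  rw [← map_pair_chainMeasure P hcons n,
    Measure.map_apply ((measurable_pi_apply n).prodMk (measurable_pi_apply (n + 1))) hA]
  rfl

end Chain

/-- **Realisation of a chain of couplings** (existence form): for consecutive probability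
couplings `P n` on `S × S`, `S` standard Borel, there is a probability measure on `ℕ → S` whose
consecutive pairs of coordinates have laws `P n`. [folklore] -/
theorem exists_measure_map_pair_eq [MeasurableSpace S] [StandardBorelSpace S] [Nonempty S]
    (P : ℕ → Measure (S × S)) [∀ n, IsProbabilityMeasure (P n)]
    (hcons : ∀ n, (P (n + 1)).fst = (P n).snd) :
    ∃ T : Measure (ℕ → S), IsProbabilityMeasure T ∧
      ∀ n, T.map (fun x ↦ (x n, x (n + 1))) = P n :=
  ⟨chainMeasure P, inferInstance, map_pair_chainMeasure P hcons⟩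

end Literature.Probability.Distributions

end
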